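import Summits.AtomisticToContinuum.Crystallization.Theorems.OverbindingBudgetAffineCompressedCutLevels

/-!
# Overbinding budget, R4 «LR(r₁)» part XI — GLUE: the two runs glued into the ℤ-indexed STACKING DATUM

Route `OverbindingBudget`, crux `RobustDefectLimitWindows`, open leaf `NearFieldSlackMinSecond 12 (1/25)` ⟸ 79K ⟸ LR(r₁).  From the BASE PATCH of
«StepA» (`base_patch_record`: sign-normalised frame `B`, copy `C₀`, level `j`, axis offset `w`, box `K₀`, coverage inequality, step count `a`) the
climbing run of «BoxBounds» (`stack_run_box_record`) is run UP (`L = 5 − j` caps) and DOWN (`L = 5 + j` caps); «Levels».`run_caps` supplies both cap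
records of every consecutive pair; the two runs are GLUED at level `j` into ℤ-indexed data on the levels `−5 … 5`:

★ `stack_levels_record` — `ref ℓ` (the origin of level `ℓ`'s layer coset: `thsum = 6ℓ`, coordinates pairwise congruent mod `3`), `Cz ℓ ∈ {F⁺,F⁻,H,H′}`
(the copy of level `ℓ`), `e ℓ = ±1` (the cap sign between levels `ℓ`, `ℓ+1`: `ref (ℓ+1) = ref ℓ + capv 1 (e ℓ) (1,1,−2)`, `capv 1 (e ℓ) δ ∈ Cz ℓ`,
`capv (−1) (−e ℓ) δ ∈ Cz (ℓ+1)` for `δ ∈ dL`), and for every `u` with `Σu = 0`-type membership `(2ℓ,2ℓ,2ℓ) + u ≡ ref ℓ (mod layer lattice)` and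
`|u_c| ≤ 18 − |ℓ|` an ESTABLISHED site labelled `(2ℓ,2ℓ,2ℓ) + u`, copy `Cz ℓ`, bounds `(τ₃₁, D₃₁)`, window `[0.9026, 1.0347]·ν`, distance `≤ 12ν`.
-/

namespace Summit.AtomisticToContinuum.Crystallization.Theorems.OverbindingBudgetAffineCompressedCutGlue

open Literature.Geometry.DiscreteGeometry (nearestDist nearestDist_nonneg fccTwoShellPattern hcpTwoShellPattern)
open Summit.AtomisticToContinuum.Crystallization.Theorems.OverbindingBudgetAffineCompressedCutKernel (T3 tsub tadd tsq thsum fccL fccNegL hcpL hcpAltL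
  capL)
open Summit.AtomisticToContinuum.Crystallization.Theorems.OverbindingBudgetAffineCompressedCutCharts (mv)
open Summit.AtomisticToContinuum.Crystallization.Theorems.OverbindingBudgetAffineCompressedCutEstablish (Estab)
open Summit.AtomisticToContinuum.Crystallization.Theorems.OverbindingBudgetAffineCompressedCutSeed (InLayer estab_mono)
open Summit.AtomisticToContinuum.Crystallization.Theorems.OverbindingBudgetAffineCompressedCutPatch (InBox capv dL inBox_mono)
open Summit.AtomisticToContinuum.Crystallization.Theorems.OverbindingBudgetAffineCompressedCutRunBox (column)
open Summit.AtomisticToContinuum.Crystallization.Theorems.OverbindingBudgetAffineCompressedCutBudget (tauR dR tauR_dR_mono window_hi window_lo)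
open Summit.AtomisticToContinuum.Crystallization.Theorems.OverbindingBudgetAffineCompressedCutBoxBounds (stack_run_box_record)
open Summit.AtomisticToContinuum.Crystallization.Theorems.OverbindingBudgetAffineCompressedCutLevels (offs_shape run_caps)

variable {N : ℕ}

/-- One run, NORMALISED: bounds weakened to `(τ₃₁, D₃₁)`, windows to `[0.9026, 1.0347]·ν`, with BOTH cap records (`run_caps`). [this file] -/
theorem run_normalised {y : Fin N → EuclideanSpace ℝ (Fin 3)} (hy : Function.Injective y) {i : Fin N} (hν : 0 < nearestDist y i)
    {A : Fin N → (EuclideanSpace ℝ (Fin 3) →ₗ[ℝ] EuclideanSpace ℝ (Fin 3))} {Qf : Fin N → (EuclideanSpace ℝ (Fin 3) →ₗᵢ[ℝ] EuclideanSpace ℝ (Fin 3))}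
    {P : Fin N → Finset (EuclideanSpace ℝ (Fin 3))} {f : Fin N → EuclideanSpace ℝ (Fin 3) → EuclideanSpace ℝ (Fin 3)}
    {B : EuclideanSpace ℝ (Fin 3) →ₗ[ℝ] EuclideanSpace ℝ (Fin 3)}
    (hP : ∀ j, dist (y j) (y i) ≤ 12 * nearestDist y i → (P j = fccTwoShellPattern ∨ P j = hcpTwoShellPattern))
    (hA : ∀ j, dist (y j) (y i) ≤ 12 * nearestDist y i → ∀ v ∈ P j, ‖A j v - Qf j v‖ ≤ 1 / 1000)
    (hf : ∀ j, dist (y j) (y i) ≤ 12 * nearestDist y i → ∀ v ∈ P j,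
      f j v ∈ Set.range y ∧ dist (f j v) (y j + nearestDist y j • A j v) ≤ 1 / 10 ^ 4 * nearestDist y j)
    (hinj : ∀ j, dist (y j) (y i) ≤ 12 * nearestDist y i → Set.InjOn (f j) ↑(P j))
    (hex : ∀ j, dist (y j) (y i) ≤ 12 * nearestDist y i → ∀ m, m ≠ j → dist (y m) (y j) ≤ (3 / 2 + 1 / 450) * nearestDist y j →
      ∃ v ∈ P j, f j v = y m)
    (hB : ∀ z, 399 / 400 * nearestDist y i * ‖z‖ ≤ ‖B z‖) (hBup : ∀ z, ‖B z‖ ≤ 401 / 400 * nearestDist y i * ‖z‖)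
    {sg : ℤ} (hsg : sg = 1 ∨ sg = -1) {C₀ : List T3} (hC₀ : C₀ ∈ [fccL, fccNegL, hcpL, hcpAltL])
    {k₀ K₀ : ℤ} {w : T3} (hw : InBox (0, 0, 0) 2 w) (hw0 : thsum w = 0) {a L : ℕ} (haL : a + L ≤ 31) (hK : K₀ ≤ 27) (hL : (L : ℤ) + 6 ≤ K₀)
    (hk : ∀ m, m < L → |k₀ + 2 * sg * ((m : ℤ) + 1)| ≤ 12)
    (hbase : ∀ x, InLayer x → InBox (0, 0, 0) K₀ x → ∃ k : Fin N, ∃ M : EuclideanSpace ℝ (Fin 3) →ₗᵢ[ℝ] EuclideanSpace ℝ (Fin 3),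
      dist (y k) (y i) ≤ 12 * nearestDist y i ∧ (9967 / 10000 : ℝ) ^ a * nearestDist y i ≤ nearestDist y k ∧
      nearestDist y k ≤ (10011 / 10000 : ℝ) ^ a * nearestDist y i ∧
      Estab y A P B i k M C₀ (tadd (tadd (k₀, k₀, k₀) w) x) (tauR (nearestDist y i) a) (dR (nearestDist y i) a)) :
    ∃ offs : ℕ → T3, ∃ Cs : ℕ → List T3, ∃ ε : ℕ → ℤ, offs 0 = (0, 0, 0) ∧ Cs 0 = C₀ ∧
      (∀ m, m < L → (ε m = 1 ∨ ε m = -1) ∧ offs (m + 1) = tadd (offs m) (capv 0 (ε m) (1, 1, -2)) ∧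
        (∀ δ ∈ dL, capv sg (ε m) δ ∈ Cs m) ∧ (∀ δ ∈ dL, capv (-sg) (-(ε m)) δ ∈ Cs (m + 1))) ∧
      ∀ m, m ≤ L → Cs m ∈ [fccL, fccNegL, hcpL, hcpAltL] ∧ thsum (offs m) = 0 ∧ (offs m).2.1 = (offs m).1 ∧ (offs m).2.2 = -2 * (offs m).1 ∧
        ∀ x, InLayer x → InBox (offs m) (K₀ - (m : ℤ)) x →
          ∃ k : Fin N, ∃ M : EuclideanSpace ℝ (Fin 3) →ₗᵢ[ℝ] EuclideanSpace ℝ (Fin 3),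
            dist (y k) (y i) ≤ 12 * nearestDist y i ∧ 9026 / 10000 * nearestDist y i ≤ nearestDist y k ∧
            nearestDist y k ≤ 10347 / 10000 * nearestDist y i ∧
            Estab y A P B i k M (Cs m) (tadd (tadd (column (tadd (k₀, k₀, k₀) w) sg (m : ℤ)) (offs m)) x)
              (tauR (nearestDist y i) 31) (dR (nearestDist y i) 31) := by
  have hΛ : (0 : ℝ) ≤ (10011 / 10000 : ℝ) ^ a * nearestDist y i := by positivity
  have hL1 : (L : ℤ) + 1 ≤ K₀ := by linarith
  obtain ⟨offs, Cs, h0, hC0, hstep, hlev⟩ :=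
    stack_run_box_record hy hν hP hA hf hinj hex hB hBup hsg hC₀ hw hw0 haL hK hL1 hk hΛ le_rfl le_rfl hbase
  have hlev' : ∀ m, m ≤ L → ∀ x, InLayer x → InBox (offs m) (K₀ - (m : ℤ)) x →
      ∃ k : Fin N, ∃ M : EuclideanSpace ℝ (Fin 3) →ₗᵢ[ℝ] EuclideanSpace ℝ (Fin 3),
        dist (y k) (y i) ≤ 12 * nearestDist y i ∧ 9026 / 10000 * nearestDist y i ≤ nearestDist y k ∧
        nearestDist y k ≤ 10347 / 10000 * nearestDist y i ∧
        Estab y A P B i k M (Cs m) (tadd (tadd (column (tadd (k₀, k₀, k₀) w) sg (m : ℤ)) (offs m)) x)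
          (tauR (nearestDist y i) 31) (dR (nearestDist y i) 31) := by
    intro m hm x hx hbox
    obtain ⟨k, M, hkr, hklo, hkhi, hE⟩ := (hlev m hm).2.2 x hx hbox
    have ham : a + m ≤ 31 := by omega
    obtain ⟨-, hτ, -, hD⟩ := tauR_dR_mono hν.le ham
    exact ⟨k, M, hkr, (window_lo hν.le le_rfl ham).trans hklo, hkhi.trans (window_hi hν.le le_rfl ham), estab_mono hE hτ hD⟩
  have hcaps := run_caps hy hν hP hA hf hinj hex hB hsg hL h0 hstep hlev'
  choose! ε hε using hcaps
  have hshape := offs_shape h0 (fun m hm => ⟨ε m, (hε m hm).2.1⟩)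
  exact ⟨offs, Cs, ε, h0, hC0, hε, fun m hm => ⟨(hlev m hm).1, (hlev m hm).2.1, (hshape m hm).1, (hshape m hm).2, hlev' m hm⟩⟩

/-- ★★★ **THE STACKING DATUM** (glue of the up-run and the down-run from the base patch; see the module docstring). [this file] -/
theorem stack_levels_record {y : Fin N → EuclideanSpace ℝ (Fin 3)} (hy : Function.Injective y) {i : Fin N} (hν : 0 < nearestDist y i)
    {A : Fin N → (EuclideanSpace ℝ (Fin 3) →ₗ[ℝ] EuclideanSpace ℝ (Fin 3))} {Qf : Fin N → (EuclideanSpace ℝ (Fin 3) →ₗᵢ[ℝ] EuclideanSpace ℝ (Fin 3))}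
    {P : Fin N → Finset (EuclideanSpace ℝ (Fin 3))} {f : Fin N → EuclideanSpace ℝ (Fin 3) → EuclideanSpace ℝ (Fin 3)}
    {B : EuclideanSpace ℝ (Fin 3) →ₗ[ℝ] EuclideanSpace ℝ (Fin 3)}
    (hP : ∀ j, dist (y j) (y i) ≤ 12 * nearestDist y i → (P j = fccTwoShellPattern ∨ P j = hcpTwoShellPattern))
    (hA : ∀ j, dist (y j) (y i) ≤ 12 * nearestDist y i → ∀ v ∈ P j, ‖A j v - Qf j v‖ ≤ 1 / 1000)
    (hf : ∀ j, dist (y j) (y i) ≤ 12 * nearestDist y i → ∀ v ∈ P j,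
      f j v ∈ Set.range y ∧ dist (f j v) (y j + nearestDist y j • A j v) ≤ 1 / 10 ^ 4 * nearestDist y j)
    (hinj : ∀ j, dist (y j) (y i) ≤ 12 * nearestDist y i → Set.InjOn (f j) ↑(P j))
    (hex : ∀ j, dist (y j) (y i) ≤ 12 * nearestDist y i → ∀ m, m ≠ j → dist (y m) (y j) ≤ (3 / 2 + 1 / 450) * nearestDist y j →
      ∃ v ∈ P j, f j v = y m)
    (hB : ∀ z, 399 / 400 * nearestDist y i * ‖z‖ ≤ ‖B z‖) (hBup : ∀ z, ‖B z‖ ≤ 401 / 400 * nearestDist y i * ‖z‖)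
    {C₀ : List T3} (hC₀ : C₀ ∈ [fccL, fccNegL, hcpL, hcpAltL]) {j : ℤ} {w : T3} {bw K₀ : ℤ} {a : ℕ} (hj : |j| ≤ 6)
    (hw : InBox (0, 0, 0) bw w) (hbw : bw ≤ 2) (hw0 : thsum w = 0) (hw12 : w.1 = w.2.1) (hw23 : (3 : ℤ) ∣ (w.2.1 - w.2.2))
    (hK : K₀ ≤ 27) (hK18 : 18 ≤ K₀) (hcov : ∀ ℓ : ℤ, |ℓ| ≤ 5 → 18 - |ℓ| + bw ≤ K₀ - |ℓ - j|) (ha : (a : ℤ) + 5 + |j| ≤ 31)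
    (hbase : ∀ x, InLayer x → InBox (0, 0, 0) K₀ x → ∃ k : Fin N, ∃ M : EuclideanSpace ℝ (Fin 3) →ₗᵢ[ℝ] EuclideanSpace ℝ (Fin 3),
      dist (y k) (y i) ≤ 12 * nearestDist y i ∧ (9967 / 10000 : ℝ) ^ a * nearestDist y i ≤ nearestDist y k ∧
      nearestDist y k ≤ (10011 / 10000 : ℝ) ^ a * nearestDist y i ∧
      Estab y A P B i k M C₀ (tadd (tadd (2 * j, 2 * j, 2 * j) w) x) (tauR (nearestDist y i) a) (dR (nearestDist y i) a)) :
    ∃ (ref : ℤ → T3) (Cz : ℤ → List T3) (e : ℤ → ℤ),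
      (∀ ℓ : ℤ, -5 ≤ ℓ → ℓ ≤ 5 → Cz ℓ ∈ [fccL, fccNegL, hcpL, hcpAltL] ∧ thsum (ref ℓ) = 6 * ℓ ∧ (ref ℓ).2.1 = (ref ℓ).1 ∧
        (3 : ℤ) ∣ ((ref ℓ).2.1 - (ref ℓ).2.2) ∧
        ∀ u : T3, InLayer (tsub (tadd (2 * ℓ, 2 * ℓ, 2 * ℓ) u) (ref ℓ)) → |u.1| ≤ 18 - |ℓ| → |u.2.1| ≤ 18 - |ℓ| → |u.2.2| ≤ 18 - |ℓ| →
          ∃ k : Fin N, ∃ M : EuclideanSpace ℝ (Fin 3) →ₗᵢ[ℝ] EuclideanSpace ℝ (Fin 3),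
            dist (y k) (y i) ≤ 12 * nearestDist y i ∧ 9026 / 10000 * nearestDist y i ≤ nearestDist y k ∧
            nearestDist y k ≤ 10347 / 10000 * nearestDist y i ∧
            Estab y A P B i k M (Cz ℓ) (tadd (2 * ℓ, 2 * ℓ, 2 * ℓ) u) (tauR (nearestDist y i) 31) (dR (nearestDist y i) 31)) ∧
      (∀ ℓ : ℤ, -5 ≤ ℓ → ℓ ≤ 4 → (e ℓ = 1 ∨ e ℓ = -1) ∧ ref (ℓ + 1) = tadd (ref ℓ) (capv 1 (e ℓ) (1, 1, -2)) ∧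
        (∀ δ ∈ dL, capv 1 (e ℓ) δ ∈ Cz ℓ) ∧ (∀ δ ∈ dL, capv (-1) (-(e ℓ)) δ ∈ Cz (ℓ + 1))) := by
  have hj' := abs_le.mp hj
  have hja : (a : ℤ) + 5 + j ≤ 31 := by linarith [le_abs_self j]
  have hja' : (a : ℤ) + 5 - j ≤ 31 := by linarith [neg_abs_le j]
  have hw2 : InBox (0, 0, 0) 2 w := inBox_mono hw hbw
  obtain ⟨hw1, hw2', hw3⟩ := hw
  simp only [add_zero] at hw1 hw2' hw3
  -- the two runs
  have haU : a + (5 - j).toNat ≤ 31 := by omega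
  have hLU : (((5 - j).toNat : ℕ) : ℤ) + 6 ≤ K₀ := by omega
  have hkU : ∀ m, m < (5 - j).toNat → |2 * j + 2 * 1 * ((m : ℤ) + 1)| ≤ 12 := by intro m hm; rw [abs_le]; omega
  obtain ⟨oU, CU, εU, hoU0, hCU0, hεU, hlevU⟩ :=
    run_normalised hy hν hP hA hf hinj hex hB hBup (sg := 1) (Or.inl rfl) hC₀ (k₀ := 2 * j) hw2 hw0 haU hK hLU hkU hbase
  have haD : a + (5 + j).toNat ≤ 31 := by omega
  have hLD : (((5 + j).toNat : ℕ) : ℤ) + 6 ≤ K₀ := by omega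
  have hkD : ∀ m, m < (5 + j).toNat → |2 * j + 2 * (-1) * ((m : ℤ) + 1)| ≤ 12 := by intro m hm; rw [abs_le]; omega
  obtain ⟨oD, CD, εD, hoD0, hCD0, hεD, hlevD⟩ :=
    run_normalised hy hν hP hA hf hinj hex hB hBup (sg := -1) (Or.inr rfl) hC₀ (k₀ := 2 * j) hw2 hw0 haD hK hLD hkD hbase
  simp only [neg_neg] at hεD
  refine ⟨fun ℓ => tadd (tadd (2 * ℓ, 2 * ℓ, 2 * ℓ) w) (if j ≤ ℓ then oU (ℓ - j).toNat else oD (j - ℓ).toNat),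
    fun ℓ => if j ≤ ℓ then CU (ℓ - j).toNat else CD (j - ℓ).toNat,
    fun ℓ => if j ≤ ℓ then εU (ℓ - j).toNat else -(εD (j - ℓ - 1).toNat), ?_, ?_⟩
  · intro ℓ hℓ1 hℓ2
    have hcl := hcov ℓ (abs_le.mpr ⟨by linarith, by linarith⟩)
    by_cases hjl : j ≤ ℓ
    · have hm : (((ℓ - j).toNat : ℕ) : ℤ) = ℓ - j := Int.toNat_of_nonneg (by linarith)
      have hmL : (ℓ - j).toNat ≤ (5 - j).toNat := by omega
      simp only [if_pos hjl]
      obtain ⟨hCmem, hth, ho2, ho3, hsites⟩ := hlevU _ hmL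
      rw [abs_of_nonneg (sub_nonneg.mpr hjl)] at hcl
      refine ⟨hCmem, ?_, ?_, ?_, ?_⟩
      · simp only [thsum, tadd] at hth hw0 ⊢; linarith
      · simp only [tadd]; linarith
      · have e3 : (2 * ℓ + w.2.1 + (oU (ℓ - j).toNat).2.1) - (2 * ℓ + w.2.2 + (oU (ℓ - j).toNat).2.2) =
            (w.2.1 - w.2.2) + 3 * (oU (ℓ - j).toNat).1 := by rw [ho2, ho3]; ring
        simp only [tadd]
        rw [e3]
        exact dvd_add hw23 (dvd_mul_right 3 _)
      · intro u hu h1 h2 h3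
        have hbox : InBox (oU (ℓ - j).toNat) (K₀ - (((ℓ - j).toNat : ℕ) : ℤ))
            (tsub (tadd (2 * ℓ, 2 * ℓ, 2 * ℓ) u) (tadd (tadd (2 * ℓ, 2 * ℓ, 2 * ℓ) w) (oU (ℓ - j).toNat))) := by
          rw [hm]
          refine ⟨?_, ?_, ?_⟩
          · calc |(tsub (tadd (2 * ℓ, 2 * ℓ, 2 * ℓ) u) (tadd (tadd (2 * ℓ, 2 * ℓ, 2 * ℓ) w) (oU (ℓ - j).toNat))).1 +
                  (oU (ℓ - j).toNat).1| = |u.1 - w.1| := by congr 1; simp only [tsub, tadd]; ring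
              _ ≤ |u.1| + |w.1| := abs_sub _ _
              _ ≤ K₀ - (ℓ - j) := by linarith
          · calc |(tsub (tadd (2 * ℓ, 2 * ℓ, 2 * ℓ) u) (tadd (tadd (2 * ℓ, 2 * ℓ, 2 * ℓ) w) (oU (ℓ - j).toNat))).2.1 +
                  (oU (ℓ - j).toNat).2.1| = |u.2.1 - w.2.1| := by congr 1; simp only [tsub, tadd]; ring
              _ ≤ |u.2.1| + |w.2.1| := abs_sub _ _
              _ ≤ K₀ - (ℓ - j) := by linarith
          · calc |(tsub (tadd (2 * ℓ, 2 * ℓ, 2 * ℓ) u) (tadd (tadd (2 * ℓ, 2 * ℓ, 2 * ℓ) w) (oU (ℓ - j).toNat))).2.2 +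
                  (oU (ℓ - j).toNat).2.2| = |u.2.2 - w.2.2| := by congr 1; simp only [tsub, tadd]; ring
              _ ≤ |u.2.2| + |w.2.2| := abs_sub _ _
              _ ≤ K₀ - (ℓ - j) := by linarith
        obtain ⟨k, M, hkr, hklo, hkhi, hE⟩ := hsites _ hu hbox
        refine ⟨k, M, hkr, hklo, hkhi, ?_⟩
        have hlab : tadd (tadd (column (tadd (2 * j, 2 * j, 2 * j) w) 1 (((ℓ - j).toNat : ℕ) : ℤ)) (oU (ℓ - j).toNat))
            (tsub (tadd (2 * ℓ, 2 * ℓ, 2 * ℓ) u) (tadd (tadd (2 * ℓ, 2 * ℓ, 2 * ℓ) w) (oU (ℓ - j).toNat))) = tadd (2 * ℓ, 2 * ℓ, 2 * ℓ) u := by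
          rw [hm]
          simp only [column, tadd, tsub, Prod.mk.injEq]
          exact ⟨by ring, by ring, by ring⟩
        rw [hlab] at hE
        exact hE
    · have hjl' : ℓ < j := lt_of_not_ge hjl
      have hm : (((j - ℓ).toNat : ℕ) : ℤ) = j - ℓ := Int.toNat_of_nonneg (by linarith)
      have hmL : (j - ℓ).toNat ≤ (5 + j).toNat := by omega
      simp only [if_neg hjl]
      obtain ⟨hCmem, hth, ho2, ho3, hsites⟩ := hlevD _ hmL
      rw [abs_sub_comm, abs_of_nonneg (by linarith : (0 : ℤ) ≤ j - ℓ)] at hcl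
      refine ⟨hCmem, ?_, ?_, ?_, ?_⟩
      · simp only [thsum, tadd] at hth hw0 ⊢; linarith
      · simp only [tadd]; linarith
      · have e3 : (2 * ℓ + w.2.1 + (oD (j - ℓ).toNat).2.1) - (2 * ℓ + w.2.2 + (oD (j - ℓ).toNat).2.2) =
            (w.2.1 - w.2.2) + 3 * (oD (j - ℓ).toNat).1 := by rw [ho2, ho3]; ring
        simp only [tadd]
        rw [e3]
        exact dvd_add hw23 (dvd_mul_right 3 _)
      · intro u hu h1 h2 h3
        have hbox : InBox (oD (j - ℓ).toNat) (K₀ - (((j - ℓ).toNat : ℕ) : ℤ))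
            (tsub (tadd (2 * ℓ, 2 * ℓ, 2 * ℓ) u) (tadd (tadd (2 * ℓ, 2 * ℓ, 2 * ℓ) w) (oD (j - ℓ).toNat))) := by
          rw [hm]
          refine ⟨?_, ?_, ?_⟩
          · calc |(tsub (tadd (2 * ℓ, 2 * ℓ, 2 * ℓ) u) (tadd (tadd (2 * ℓ, 2 * ℓ, 2 * ℓ) w) (oD (j - ℓ).toNat))).1 +
                  (oD (j - ℓ).toNat).1| = |u.1 - w.1| := by congr 1; simp only [tsub, tadd]; ring
              _ ≤ |u.1| + |w.1| := abs_sub _ _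
              _ ≤ K₀ - (j - ℓ) := by linarith
          · calc |(tsub (tadd (2 * ℓ, 2 * ℓ, 2 * ℓ) u) (tadd (tadd (2 * ℓ, 2 * ℓ, 2 * ℓ) w) (oD (j - ℓ).toNat))).2.1 +
                  (oD (j - ℓ).toNat).2.1| = |u.2.1 - w.2.1| := by congr 1; simp only [tsub, tadd]; ring
              _ ≤ |u.2.1| + |w.2.1| := abs_sub _ _
              _ ≤ K₀ - (j - ℓ) := by linarith
          · calc |(tsub (tadd (2 * ℓ, 2 * ℓ, 2 * ℓ) u) (tadd (tadd (2 * ℓ, 2 * ℓ, 2 * ℓ) w) (oD (j - ℓ).toNat))).2.2 +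
                  (oD (j - ℓ).toNat).2.2| = |u.2.2 - w.2.2| := by congr 1; simp only [tsub, tadd]; ring
              _ ≤ |u.2.2| + |w.2.2| := abs_sub _ _
              _ ≤ K₀ - (j - ℓ) := by linarith
        obtain ⟨k, M, hkr, hklo, hkhi, hE⟩ := hsites _ hu hbox
        refine ⟨k, M, hkr, hklo, hkhi, ?_⟩
        have hlab : tadd (tadd (column (tadd (2 * j, 2 * j, 2 * j) w) (-1) (((j - ℓ).toNat : ℕ) : ℤ)) (oD (j - ℓ).toNat))
            (tsub (tadd (2 * ℓ, 2 * ℓ, 2 * ℓ) u) (tadd (tadd (2 * ℓ, 2 * ℓ, 2 * ℓ) w) (oD (j - ℓ).toNat))) = tadd (2 * ℓ, 2 * ℓ, 2 * ℓ) u := by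
          rw [hm]
          simp only [column, tadd, tsub, Prod.mk.injEq]
          exact ⟨by ring, by ring, by ring⟩
        rw [hlab] at hE
        exact hE
  · intro ℓ hℓ1 hℓ2
    by_cases hjl : j ≤ ℓ
    · have hjl1 : j ≤ ℓ + 1 := by linarith
      have hmL : (ℓ - j).toNat < (5 - j).toNat := by omega
      have hm1 : (ℓ + 1 - j).toNat = (ℓ - j).toNat + 1 := by omega
      simp only [if_pos hjl, if_pos hjl1]
      rw [hm1]
      obtain ⟨hε, hstep, hcu, hcd⟩ := hεU _ hmL
      refine ⟨hε, ?_, hcu, hcd⟩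
      rw [hstep]
      simp only [tadd, capv, Prod.mk.injEq]
      exact ⟨by ring, by ring, by ring⟩
    · by_cases hjl1 : j ≤ ℓ + 1
      · have hjeq : j = ℓ + 1 := le_antisymm hjl1 (by omega)
        have e1 : (j - ℓ).toNat = 0 + 1 := by omega
        have e0 : (j - ℓ - 1).toNat = 0 := by omega
        have e0' : (ℓ + 1 - j).toNat = 0 := by omega
        have hLD0 : 0 < (5 + j).toNat := by omega
        simp only [if_neg hjl, if_pos hjl1]
        rw [e1, e0, e0', hoU0, hCU0]
        obtain ⟨hε, hstep, hcu, hcd⟩ := hεD 0 hLD0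
        refine ⟨by rcases hε with h | h <;> omega, ?_, hcd, ?_⟩
        · rw [hstep, hoD0]
          simp only [tadd, capv, Prod.mk.injEq]
          exact ⟨by ring, by ring, by ring⟩
        · intro δ hδ
          rw [← hCD0, neg_neg]
          exact hcu δ hδ
      · have hmL : (j - ℓ - 1).toNat < (5 + j).toNat := by omega
        have e1 : (j - ℓ).toNat = (j - ℓ - 1).toNat + 1 := by omega
        have e0 : (j - (ℓ + 1)).toNat = (j - ℓ - 1).toNat := by omega
        simp only [if_neg hjl, if_neg hjl1]
        rw [e1, e0]
        obtain ⟨hε, hstep, hcu, hcd⟩ := hεD _ hmL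
        refine ⟨by rcases hε with h | h <;> omega, ?_, hcd, ?_⟩
        · rw [hstep]
          simp only [tadd, capv, Prod.mk.injEq]
          exact ⟨by ring, by ring, by ring⟩
        · intro δ hδ
          rw [neg_neg]
          exact hcu δ hδ

end Summit.AtomisticToContinuum.Crystallization.Theorems.OverbindingBudgetAffineCompressedCutGlue
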